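import Summits.BirchSwinnertonDyer.Rank1Residual.GaloisImage.LocalUnitsSubgroup
import Literature.NumberTheory.GaloisRepresentations.LocalFieldProofs
import HarnessLib

/-!
# The valuation sequence `0 → 𝒪_Eˣ/p → Eˣ/p → ℤ/p → 0` and `Eˣ[p] = 𝒪_Eˣ[p]` as Galois modules
# (cell `b2b-bsdres`, team n1011, row T-EPC = Tate's local Euler–Poincaré characteristic; seat p04 GEN 7; stage B5a)

HONEST FRAMING (cell `b2b-bsdres`, run/shared/lean/b2b/bsd-rank1-residual/, verbatim in every
file): the goal of the cell is to DELETE the COMBINATION-SHAPED residual classes of the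
Birch–Swinnerton-Dyer formula for ALL analytic-rank `≤ 1` elliptic curves over `ℚ` — "full BSD
formula for every rank `≤ 1` curve in class `C`" assembled STRICTLY from published theorems — so
that the rank-`≤ 1` remainder becomes exactly the CONSTRUCTION-SHAPED classes, which are TYPED
(missing-input `Prop`s), NOT attempted. This is not "finishing BSD". Team n1011 (N10 / N11, the
additive block X4 ∧ `p = 3`): research route; no claim beyond the stated classes; nothing is
booked; no mark / label is changed by this file. Theorems only (no definition, no named fact, no
`sorry`); TOOL theorems on local fields.  (Placement: Summits/GaloisImage pending the operator
move of the T-EPC cone to the Literature homes.)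

## What

`E` a non-archimedean local field; the integer-valued valuation
`ord(x) = log (valueGroupWithZeroIsoInt E (v x))` (no new definition: used inline).

* `OneUnits.log_valuation_mul`, `log_valuation_eq_zero_iff` (`ord u = 0 ↔ u ∈ 𝒪_Eˣ`),
  `exists_log_valuation_eq_neg_one` (a uniformizer);
* `OneUnits.torsion_le_units` — `Eˣ[p] ≤ 𝒪_Eˣ`; `nonempty_equiv_torsion_units` — the inclusion is
  an equivalence of `Gal(E/K)`-representations `𝒪_Eˣ[p] ≃ Eˣ[p]`;
* `OneUnits.mem_range_lsmul_units` — `𝒪_Eˣ ∩ (Eˣ)^p = (𝒪_Eˣ)^p` (injectivity of `𝒪_Eˣ/p → Eˣ/p`).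

The counted sequence `#Hom_Δ(Z, Eˣ/p) = #Hom_Δ(Z, 𝒪_Eˣ/p) · #Z^Δ` is stage B5b.

References: J.-P. Serre, *Local Fields*, XIV §4 [SerreLocalFields1979]; J. S. Milne, *Arithmetic
Duality Theorems* (2006), I §2, Lemma 2.11 [MilneADT2006].
-/

noncomputable section

open Function
open scoped ValuativeRel

namespace Summit.BirchSwinnertonDyer.Rank1Residual.GaloisImage

namespace OneUnits

open Representation

variable {K : Type*} [Field K] {E : Type*} [Field E] [Algebra K E] [ValuativeRel E]
  [TopologicalSpace E] [IsNonarchimedeanLocalField E]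
variable (p : ℕ) [hp : Fact p.Prime]

/-! ### The integer-valued valuation -/

section Ord

omit hp in
/-- `valueGroupWithZeroIsoInt E (v x) ≠ 0` for `x ≠ 0`. [folklore] -/
theorem iso_valuation_ne_zero {x : E} (hx : x ≠ 0) :
    IsNonarchimedeanLocalField.valueGroupWithZeroIsoInt E (ValuativeRel.valuation E x) ≠ 0 := by
  have hv : ValuativeRel.valuation E x ≠ 0 := (Valuation.ne_zero_iff _).2 hx
  have hu : ((Units.mapEquiv (IsNonarchimedeanLocalField.valueGroupWithZeroIsoInt E).toMulEquiv
      (Units.mk0 _ hv) : (WithZero (Multiplicative ℤ))ˣ) : WithZero (Multiplicative ℤ)) =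
      IsNonarchimedeanLocalField.valueGroupWithZeroIsoInt E (ValuativeRel.valuation E x) :=
    Units.coe_mapEquiv _ _
  rw [← hu]
  exact Units.ne_zero _

omit hp in
/-- `ord(xy) = ord x + ord y` for `x, y ≠ 0`. [folklore] -/
theorem log_valuation_mul {x y : E} (hx : x ≠ 0) (hy : y ≠ 0) :
    WithZero.log (IsNonarchimedeanLocalField.valueGroupWithZeroIsoInt E
        (ValuativeRel.valuation E (x * y))) =
      WithZero.log (IsNonarchimedeanLocalField.valueGroupWithZeroIsoInt E (ValuativeRel.valuation E x)) +
      WithZero.log (IsNonarchimedeanLocalField.valueGroupWithZeroIsoInt E (ValuativeRel.valuation E y)) := by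
  rw [map_mul, map_mul]
  exact WithZero.log_mul (iso_valuation_ne_zero hx) (iso_valuation_ne_zero hy)

omit hp in
/-- `ord x = 0 ↔ v(x) = 1` for `x ≠ 0`. [folklore] -/
theorem log_valuation_eq_zero_iff {x : E} (hx : x ≠ 0) :
    WithZero.log (IsNonarchimedeanLocalField.valueGroupWithZeroIsoInt E (ValuativeRel.valuation E x)) = 0 ↔
      ValuativeRel.valuation E x = 1 := by
  have hne := iso_valuation_ne_zero hx (E := E)
  constructor
  · intro h
    have h2 := WithZero.exp_log hne
    rw [h, WithZero.exp_zero] at h2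
    rw [← (IsNonarchimedeanLocalField.valueGroupWithZeroIsoInt E).injective.eq_iff, map_one]
    exact h2.symm
  · intro h
    rw [h, map_one, WithZero.log_one]

omit hp [TopologicalSpace E] [IsNonarchimedeanLocalField E] in
/-- A unit `u ∈ Eˣ` lies in `𝒪_Eˣ` (both `u` and `u⁻¹` integral) iff `v(u) = 1`. [folklore] -/
theorem mem_units_iff_valuation_eq_one (u : Eˣ) :
    ((u : E) ∈ 𝒪[E] ∧ ((u⁻¹ : Eˣ) : E) ∈ 𝒪[E]) ↔ ValuativeRel.valuation E (u : E) = 1 := by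
  rw [Valuation.mem_integer_iff, Valuation.mem_integer_iff, Units.val_inv_eq_inv_val, map_inv₀]
  constructor
  · rintro ⟨h1, h2⟩
    have hne : ValuativeRel.valuation E (u : E) ≠ 0 := (Valuation.ne_zero_iff _).2 u.ne_zero
    have h3 : 1 ≤ ValuativeRel.valuation E (u : E) := by
      rwa [inv_le_one₀ (zero_lt_iff.2 hne)] at h2
    exact le_antisymm h1 h3
  · intro h
    rw [h, inv_one]
    exact ⟨le_rfl, le_rfl⟩

omit hp in
/-- **A uniformizer**: there is `ϖ ∈ Eˣ` with `ord ϖ = -1`. [folklore] -/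
theorem exists_log_valuation_eq_neg_one :
    ∃ ϖ : Eˣ, WithZero.log (IsNonarchimedeanLocalField.valueGroupWithZeroIsoInt E
      (ValuativeRel.valuation E (ϖ : E))) = -1 := by
  obtain ⟨x, hx⟩ := ValuativeRel.valuation_surjective (K := E)
    ((Valuation.IsRankOneDiscrete.generator (ValuativeRel.valuation E) :
      (ValuativeRel.ValueGroupWithZero E)ˣ) : ValuativeRel.ValueGroupWithZero E)
  have hx0 : x ≠ 0 := by
    intro h
    rw [h, map_zero] at hx
    exact (Units.ne_zero _) hx.symm
  refine ⟨Units.mk0 x hx0, ?_⟩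
  rw [Units.val_mk0, hx,
    Literature.NumberTheory.GaloisRepresentations.IsNonarchimedeanLocalField.valueGroupWithZeroIsoInt_generator,
    WithZero.log_exp]

end Ord

/-! ### `Eˣ[p] = 𝒪_Eˣ[p]` -/

section Torsion

omit hp [TopologicalSpace E] [IsNonarchimedeanLocalField E] in
/-- **`Eˣ[p] ≤ 𝒪_Eˣ`**: a `p`-torsion unit has valuation `1`. [folklore] -/
theorem torsion_le_units (hp0 : p ≠ 0) (OU : Submodule ℤ (Additive Eˣ))
    (hOU : ∀ u : Additive Eˣ, u ∈ OU ↔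
      ((Additive.toMul u : Eˣ) : E) ∈ 𝒪[E] ∧ (((Additive.toMul u)⁻¹ : Eˣ) : E) ∈ 𝒪[E]) :
    LinearMap.ker (LinearMap.lsmul ℤ (Additive Eˣ) p) ≤ OU := by
  intro u hu
  rw [LinearMap.mem_ker, LinearMap.lsmul_apply, natCast_zsmul] at hu
  rw [hOU, mem_units_iff_valuation_eq_one]
  have h : ((Additive.toMul u : Eˣ) : E) ^ p = 1 := by
    rw [← Units.val_pow_eq_pow_val, ← toMul_nsmul, hu, toMul_zero, Units.val_one]
  have h2 : ValuativeRel.valuation E ((Additive.toMul u : Eˣ) : E) ^ p = 1 := by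
    rw [← map_pow, h, map_one]
  rcases pow_eq_one_iff.1 h2 with h | h
  · exact h
  · exact absurd h hp0

omit hp [TopologicalSpace E] [IsNonarchimedeanLocalField E] in
/-- **`𝒪_Eˣ[p] ≃ Eˣ[p]` as `Gal(E/K)`-representations** (the inclusion). [folklore] -/
theorem nonempty_equiv_torsion_units (hp0 : p ≠ 0) (OU : Submodule ℤ (Additive Eˣ))
    (hOU : ∀ u : Additive Eˣ, u ∈ OU ↔
      ((Additive.toMul u : Eˣ) : E) ∈ 𝒪[E] ∧ (((Additive.toMul u)⁻¹ : Eˣ) : E) ∈ 𝒪[E])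
    (hOUst : ∀ σ, OU ≤ OU.comap (Representation.ofMulDistribMulAction (E ≃ₐ[K] E) Eˣ σ)) :
    Nonempty ((((Representation.ofMulDistribMulAction (E ≃ₐ[K] E) Eˣ).subrepresentation OU hOUst).subrepresentation _
        (ModPRepCount.ker_lsmul_le_comap
          ((Representation.ofMulDistribMulAction (E ≃ₐ[K] E) Eˣ).subrepresentation OU hOUst) p)).Equiv
      ((Representation.ofMulDistribMulAction (E ≃ₐ[K] E) Eˣ).subrepresentation _
        (ModPRepCount.ker_lsmul_le_comap (Representation.ofMulDistribMulAction (E ≃ₐ[K] E) Eˣ) p))) := by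
  classical
  have hι : ∀ t : LinearMap.ker (LinearMap.lsmul ℤ OU p),
      ((t : OU) : Additive Eˣ) ∈ LinearMap.ker (LinearMap.lsmul ℤ (Additive Eˣ) p) := fun t => by
    have ht := t.2
    rw [LinearMap.mem_ker, LinearMap.lsmul_apply] at ht ⊢
    have := congrArg (fun x : OU => (x : Additive Eˣ)) ht
    simpa only [Submodule.coe_smul_of_tower, Submodule.coe_zero] using this
  let κ : LinearMap.ker (LinearMap.lsmul ℤ OU p) →ₗ[ℤ] LinearMap.ker (LinearMap.lsmul ℤ (Additive Eˣ) p) :=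
    (OU.subtype.comp (LinearMap.ker (LinearMap.lsmul ℤ OU p)).subtype).codRestrict _ hι
  have hinj : Injective κ := fun a b h => by
    have h' := congrArg (fun t : LinearMap.ker (LinearMap.lsmul ℤ (Additive Eˣ) p) => (t : Additive Eˣ)) h
    exact Subtype.ext (Subtype.ext h')
  have hsurj : Surjective κ := by
    intro t
    have htO : (t : Additive Eˣ) ∈ OU := torsion_le_units p hp0 OU hOU t.2
    have ht := t.2
    rw [LinearMap.mem_ker, LinearMap.lsmul_apply] at ht
    refine ⟨⟨⟨_, htO⟩, ?_⟩, Subtype.ext rfl⟩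
    rw [LinearMap.mem_ker, LinearMap.lsmul_apply]
    exact Subtype.ext ht
  exact ⟨Representation.Equiv.mk (LinearEquiv.ofBijective κ ⟨hinj, hsurj⟩) fun g => LinearMap.ext fun x =>
    Subtype.ext rfl⟩

end Torsion

/-! ### `𝒪_Eˣ ∩ (Eˣ)^p = (𝒪_Eˣ)^p` -/

section Pure

omit hp in
/-- If `u ∈ 𝒪_Eˣ` is a `p`-th power in `Eˣ`, it is a `p`-th power in `𝒪_Eˣ` (`ord` is `ℤ`-valued and
`ℤ` is torsion-free). [folklore] -/
theorem mem_range_lsmul_units (hp0 : p ≠ 0) (OU : Submodule ℤ (Additive Eˣ))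
    (hOU : ∀ u : Additive Eˣ, u ∈ OU ↔
      ((Additive.toMul u : Eˣ) : E) ∈ 𝒪[E] ∧ (((Additive.toMul u)⁻¹ : Eˣ) : E) ∈ 𝒪[E])
    (u : OU) (w : Additive Eˣ) (hw : (p : ℤ) • w = (u : Additive Eˣ)) :
    u ∈ LinearMap.range (LinearMap.lsmul ℤ OU p) := by
  have hwO : w ∈ OU := by
    rw [hOU, mem_units_iff_valuation_eq_one, ← log_valuation_eq_zero_iff (Units.ne_zero _)]
    have hu := ((hOU _).1 u.2)
    rw [mem_units_iff_valuation_eq_one, ← log_valuation_eq_zero_iff (Units.ne_zero _)] at hu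
    have hpow : ((Additive.toMul (u : Additive Eˣ) : Eˣ) : E) = ((Additive.toMul w : Eˣ) : E) ^ p := by
      rw [← hw, natCast_zsmul, toMul_nsmul, Units.val_pow_eq_pow_val]
    rw [hpow, map_pow, map_pow, WithZero.log_pow, nsmul_eq_mul] at hu
    rcases mul_eq_zero.1 hu with h | h
    · exact absurd (by exact_mod_cast h) hp0
    · exact h
  exact ⟨⟨w, hwO⟩, Subtype.ext (by rw [LinearMap.lsmul_apply, Submodule.coe_smul_of_tower]; exact hw)⟩

end Pure

end OneUnits

end Summit.BirchSwinnertonDyer.Rank1Residual.GaloisImage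

end
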